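import Literature.Geometry.Riemannian.ChangGurskyYangProofs
import Literature.Geometry.Riemannian.ChangGurskyYang
import Literature.Geometry.Riemannian.YamabeConstant
import Literature.Geometry.Riemannian.YamabePositivity
import Literature.Geometry.Riemannian.ChangGurskyYangTheorem14
import HarnessLib

/-!
# Route EntropyRung · crux `ChangGurskyYang` · line `margerin-cone-hamilton-rails` — STUB 6
# (`stub_thm14Psc`: Chang–Gursky–Yang 2003, Thm. 1.4 with `α = 1`, connected `scal > 0` shape)

STUB 6 of the skeleton `Cruxes/ChangGurskyYang/Lines/margerin-cone-hamilton-rails.lean` of crux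
stmt-SmoothPoincare4-10834 (`Summit.SmoothPoincare4.SmoothPoincare4.Theses.EntropyRung.ChangGurskyYang`)
asks: on a closed CONNECTED smooth four-manifold, a `C^∞` Riemannian metric `g₀` with `R > 0` and
`¼∫|W|² dV < ∫σ₂(A) dV` is conformal to a `C^∞` Riemannian `g` (with a Levi-Civita connection)
with `R > 0` and `¼|W|² < σ₂(A)` POINTWISE. Its analytic core is Chang–Gursky–Yang 2003, Thm. 1.4
(`α = 1`) — a fully nonlinear conformal PDE ([CGY1] = Chang–Gursky–Yang, Ann. of Math. 155 (2002):
the `δ`-regularised fourth-order equation and its a-priori estimates; or the Gursky–Viaclovsky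
2003 continuity path carrying the Weyl weight), which the tree does not contain and which is not
provable in a session. Following the NEED-A-PUBLISHED-FACT rule, Thm. 1.4 (`α = 1`) was STATED
as the closed named fact `Literature.Geometry.Riemannian.changGurskyYang_theorem14_four`
(`Literature/Geometry/Riemannian/ChangGurskyYangTheorem14.lean`, relocated there by the gate from the
first version of this file), in the tree's vocabulary (`yamabeConstant`, `weylEnergy`,
`sigma2WeylSchoutenIntegral`, `weylNormSq`, `sigma2WeylSchouten`, `IsConformalTo`,
`toContMDiffRiemannianMetric`) and in the PRINTED shape — hypothesis `Y(M,[g₀]) > 0`, conclusion a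
conformal metric with `σ₂(A_g) − ¼|W_g|² > 0` pointwise — on CONNECTED closed four-manifolds (the
paper's standing convention; the statement with `[ConnectedSpace M]` dropped, which is verbatim the
hypothesis `hThm14` of the tree's reduction
`changGurskyYang_sphere_four_of_margerin_of_chernGaussBonnet_of_thm14`, is FALSE on `S⁴ ⊔ S³×S¹`:
`Y > 0` and `¼∫|W|² = 0 < 16π² = ∫σ₂(A)`, yet on the `S³×S¹` component `∫σ₂(A_g) dV_g = 0` for
every conformal `g`, so `σ₂(A_g) > 0` pointwise is impossible there — Disproof §7 of the crux
workfile). This file PROVES the stub CONDITIONALLY on that fact, `stub_thm14Psc_of_theorem14`, by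
the two printed bookkeeping steps that ARE theorems of the tree: `scal_{g₀} > 0 ⇒ Y(M,[g₀]) > 0`
(Aubin 1982, §6.5: `yamabeConstant_pos_of_scalarCurvature_pos`, `YamabePositivity.lean`) on the
input side, and Chang–Gursky–Yang 2003, p. 108, "this implies in particular that `R > 0`" on the
output side (`scalarCurvature_ne_zero_of_sigma2WeylSchouten_gt`: pointwise `¼|W|² < σ₂(A)` forces
`R ≠ 0`; `yamabeConstant_eq_of_isConformalTo`: `Y` is a conformal invariant;
`scalarCurvature_pos_of_yamabeConstant_pos`: a nowhere-zero continuous `R` with `Y > 0` on a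
connected `M` is positive — all in `ChangGurskyYangProofs.lean` / `YamabeConstant.lean`).

So the stub `stub_thm14Psc` is exactly `stub_thm14Psc_of_theorem14 h` for
`h : changGurskyYang_theorem14_four`, and the line is closed at this leaf MODULO the named fact.

References: S.-Y. A. Chang, M. J. Gursky, P. C. Yang, Publ. Math. IHÉS 98 (2003) 105–143, §1,
(1.1)–(1.2) (p. 111), Thm. 1.4 with (1.9)–(1.10) (pp. 112–113), p. 108, §2 (p. 121)
[ChangGurskyYang2003]; S.-Y. A. Chang, M. J. Gursky, P. C. Yang, Ann. of Math. 155 (2002) 709–787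
([CGY1], the existence theory behind Thm. 1.4); M. J. Gursky, J. A. Viaclovsky, J. Differential
Geom. 63 (2003) 131–154, Thm. 1 and Props. 2–6 (the continuity-method proof) [GurskyViaclovsky2003];
T. Aubin, Grundlehren 252 (1982), Ch. 6, §6.5 [Aubin1982].
-/

noncomputable section

open scoped Manifold ContDiff Topology ENNReal
open Literature.Geometry.Lorentzian Literature.Geometry.Lorentzian.PseudoRiemannianMetric
open Literature.Geometry.Riemannian MeasureTheory Module

-- every `Summit.SmoothPoincare4.SmoothPoincare4.…` name repeats the summit = sub-problem segment (D-0017 layout)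
set_option linter.dupNamespace false

namespace Summit.SmoothPoincare4.SmoothPoincare4.Theorems.MargerinRails

/-- **STUB 6 of line `margerin-cone-hamilton-rails`, conditionally on Chang–Gursky–Yang 2003,
Thm. 1.4** (the registered stub `stub_thm14Psc` = Disproof §7 `Thm14LeafPsc`, verbatim after the
arrow): on a closed connected smooth four-manifold, a `C^∞` Riemannian `g₀` with `R > 0` and
`¼∫|W|² < ∫σ₂(A)` is conformal to a `C^∞` Riemannian `g` (with a Levi-Civita connection) with
`R > 0` and `¼|W|² < σ₂(A)` pointwise. Proof as printed: `scal_{g₀} > 0 ⇒ Y(M,[g₀]) > 0` (Aubin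
1982, §6.5; tree theorem `yamabeConstant_pos_of_scalarCurvature_pos`), Thm. 1.4 gives the conformal
`g` with `¼|W_g|² < σ₂(A_g)`, and "this implies in particular that `R > 0`" (Chang–Gursky–Yang
2003, p. 108): pointwise `R_g ≠ 0` (`scalarCurvature_ne_zero_of_sigma2WeylSchouten_gt`),
`Y(M,[g]) = Y(M,[g₀]) > 0` (`yamabeConstant_eq_of_isConformalTo`), hence `R_g > 0` on the connected
`M` (`scalarCurvature_pos_of_yamabeConstant_pos`).
[cite: ChangGurskyYang2003, Thm. 1.4 and p. 108] [cite: Aubin1982, Ch. 6, §6.5] -/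
theorem stub_thm14Psc_of_theorem14 : changGurskyYang_theorem14_four →
    ∀ (M : Type) [TopologicalSpace M] [T2Space M] [SecondCountableTopology M]
      [ChartedSpace (EuclideanSpace ℝ (Fin 4)) M] [IsManifold (𝓡 4) ∞ M] [CompactSpace M]
      [ConnectedSpace M] [MeasurableSpace M] [BorelSpace M]
      (g₀ : PseudoRiemannianMetric (𝓡 4) ∞ (EuclideanSpace ℝ (Fin 4)) (TangentSpace (𝓡 4) : M → Type _))
      [g₀.HasLeviCivita] (hg₀ : g₀.IsRiemannian),
      (∀ x, 0 < g₀.scalarCurvature x) →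
      1 / 4 * g₀.weylEnergy.toReal < g₀.sigma2WeylSchoutenIntegral →
      ∃ (g : PseudoRiemannianMetric (𝓡 4) ∞ (EuclideanSpace ℝ (Fin 4)) (TangentSpace (𝓡 4) : M → Type _))
        (_ : g.HasLeviCivita) (hg : g.IsRiemannian),
        IsConformalTo (g.toContMDiffRiemannianMetric hg) (g₀.toContMDiffRiemannianMetric hg₀) ∧
        (∀ x, 0 < g.scalarCurvature x) ∧ ∀ x, 1 / 4 * g.weylNormSq x < g.sigma2WeylSchouten x := by
  intro h M _ _ _ _ _ _ _ _ _ g₀ _ hg₀ hscal hint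
  have hE : finrank ℝ (EuclideanSpace ℝ (Fin 4)) = 4 := finrank_euclideanSpace_fin
  -- Aubin: `scal > 0 ⇒ Y > 0`
  have hY : 0 < yamabeConstant (g₀.toContMDiffRiemannianMetric hg₀) :=
    yamabeConstant_pos_of_scalarCurvature_pos g₀ hg₀ hscal
  -- Thm. 1.4 (α = 1): the conformal metric with `¼|W|² < σ₂(A)` pointwise
  obtain ⟨g, hLC, hg, hconf, hpt⟩ := h M g₀ hg₀ hY hint
  have hpos : ∀ (x : M) (v : TangentSpace (𝓡 4) x), v ≠ 0 → 0 < g.val x v v :=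
    fun x v hv ↦ hg x v hv
  -- p. 108: `R ≠ 0` pointwise, `Y` conformally invariant, hence `R > 0` on the connected `M`
  have hne : ∀ x, g.scalarCurvature x ≠ 0 := fun x ↦
    g.scalarCurvature_ne_zero_of_sigma2WeylSchouten_gt (WithTop.coe_le_coe.mpr le_top) hE
      (hpos x) (hpt x)
  have hY' : 0 < yamabeConstant (g.toContMDiffRiemannianMetric hg) := by
    rwa [yamabeConstant_eq_of_isConformalTo hconf]
  exact ⟨g, hLC, hg, hconf, g.scalarCurvature_pos_of_yamabeConstant_pos hg hY' hne, hpt⟩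

end Summit.SmoothPoincare4.SmoothPoincare4.Theorems.MargerinRails

end
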